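import Mathlib
import HarnessLib
import HarnessLib.Audit
import Summits.AtomisticToContinuum.Statement
import Literature.Analysis.FluidPDE.HardSphereFlowConstruction
import Summits.AtomisticToContinuum.HydrodynamicLimit.Theorems.LambertianContactSwapLambertianEulerCollisionalInputs

/-!
# Scratch (crux-strategist s2, stmt-11854): the four split children elaborate in the ROUTE FILE's context

Imports = the route file `Theses/LambertianContactSwap.lean` imports (rev 9) + the ONE import the split adds
(`…LambertianEulerCollisionalInputs`, which brings `…KineticInputs`; its import closure does not contain the route file — no cycle).
Namespace / `open`s copied from the route file.  The bodies below are byte-identical to `children.json[i].statement`.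
-/

namespace Summit.AtomisticToContinuum.HydrodynamicLimit.Theses.LambertianContactSwapSim

open scoped BigOperators Topology Manifold Classical MeasureTheory ProbabilityTheory Matrix InnerProductSpace ComplexConjugate ContinuousMap
open Filter Set Function TopologicalSpace MeasureTheory

/-- child 1 (crux): window large deviations under local-Gibbs restart = KCW-Λ ∧ CCW-Λ (by name). -/
def WindowLDLambda : Prop :=
  Summit.AtomisticToContinuum.HydrodynamicLimit.Theorems.LambertianContactSwapLambertianEulerKineticInputs.KineticClampedWindowLDLambda ∧ Summit.AtomisticToContinuum.HydrodynamicLimit.Theorems.LambertianContactSwapLambertianEulerCollisionalInputs.CollisionalClampedWindowLDLambda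

/-- child 2 (crux): Gaussian velocity tails along Λ under the true law = TL1G-Λ (by name). -/
def GaussianVelocityTailsLambda : Prop :=
  Summit.AtomisticToContinuum.HydrodynamicLimit.Theorems.LambertianContactSwapLambertianEulerKineticInputs.GaussianVelocityTailsLambda

/-- child 3 (crux): collision-activity tails along Λ under the true law = CAT-Λ (by name). -/
def CollisionActivityTailsLambda : Prop :=
  Summit.AtomisticToContinuum.HydrodynamicLimit.Theorems.LambertianContactSwapLambertianEulerCollisionalInputs.CollisionActivityTailsLambda

/-- child 4 (support, residual): dilute self-consistency, VERBATIM stmt-AtomisticToContinuum-3091. -/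
def DiluteSelfConsistency : Prop :=
  ∀ η : ℝ, 0 < η → ∀ (a₀ θ₀ : Literature.MathematicalPhysics.KineticTheory.T3 → ℝ) (u₀ : Literature.MathematicalPhysics.KineticTheory.T3 → Literature.MathematicalPhysics.KineticTheory.V3), Continuous a₀ → Continuous θ₀ → Continuous u₀ → (∀ x, 0 < a₀ x) → (∀ x, 0 < θ₀ x) → ∃ σ₀ : ℝ, 0 < σ₀ ∧ ∀ σ : ℝ, 0 < σ → σ < σ₀ → ∀ (T : ℝ) (ρ θ : ℝ → Literature.MathematicalPhysics.KineticTheory.T3 → ℝ) (u : ℝ → Literature.MathematicalPhysics.KineticTheory.T3 → Literature.MathematicalPhysics.KineticTheory.V3), Literature.MathematicalPhysics.KineticTheory.IsHardSphereEulerSolution σ T ρ u θ → ∀ Φ : (N : ℕ) → Literature.Analysis.FluidPDE.HardSphereFlow (Literature.Analysis.FluidPDE.Torus.geometry (Fin 3)) (Literature.MathematicalPhysics.KineticTheory.hsDiameter σ N) (N + 1), Literature.MathematicalPhysics.KineticTheory.TendstoHydroFieldsAt (fun N => Literature.MathematicalPhysics.KineticTheory.localGibbsLaw σ a₀ u₀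 θ₀ N (Φ N)) Φ ρ u θ 0 → ∀ t ∈ Set.Ico 0 T, ∀ x, ρ t x * σ ^ 3 < η

/-- sanity: child 2 is literally the named input (delta). -/
example : GaussianVelocityTailsLambda ↔
    Summit.AtomisticToContinuum.HydrodynamicLimit.Theorems.LambertianContactSwapLambertianEulerKineticInputs.GaussianVelocityTailsLambda :=
  Iff.rfl

end Summit.AtomisticToContinuum.HydrodynamicLimit.Theses.LambertianContactSwapSim
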